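import Literature.AlgebraicGeometry.Resolution.SeparablyDefectlessRationalVTProofs
import Literature.AlgebraicGeometry.Resolution.DefectlessCoarsening
import Literature.AlgebraicGeometry.Resolution.DefectlessDedekind
import Literature.AlgebraicGeometry.Resolution.Kuhlmann2019HenselianRationalityFiniteRank
import Literature.AlgebraicGeometry.Resolution.GeneralizedStabilityAlgClosedHolds
import HarnessLib

/-!
# Kuhlmann 2010, Thm. 1.1, "separably defectless" clause for `K(x)`, `x` residue-transcendental over a separably closed `K`: reduction to (R2)

Topic: `Literature/AlgebraicGeometry/Resolution` (valued function fields). Proof layer for the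
named fact `Kuhlmann2010SeparablyDefectlessRationalRT_sepClosed`
(`Kuhlmann2019HenselianRationalityFiniteRank.lean`) = F.-V. Kuhlmann, *Elimination of
ramification I: The generalized stability theorem*, Trans. AMS 362 (2010) = arXiv:1003.5678,
**Thm. 1.1, the "separably defectless" clause**, for `F = K(x)` with `x` residue-transcendental
over a separably closed `K` (as quoted by Kuhlmann 2019, proof of Prop. 5.6: "Since `xP₁` is
transcendental over `KP₁`, we can apply [16, Theorem 1] to find that `(K(x),P₁)` is a separably
defectless field").

As for the value-transcendental twin (`SeparablyDefectlessRationalVTProofs.lean`), the printed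
proof (§5, p. 20: passage to the completion, [K6], and the "defectless" version of Thm. 1.1) is
followed with the completion of `K` replaced by the algebraic closure `K'` of `K` inside an
algebraic closure `Ω̄ ⊇ Ω`, a purely inseparable extension of the separably closed `K` in which
`K` is dense when the valuation is non-trivial on `K` (`SeparablyClosedDensity.lean`): `K(x)` is
dense in `K'(x)` (`RationalFunctionFieldDensity.lean`; `vK'(x) = vK'`), `(K'(x), v)` is defectless
by (R2) for the residue-transcendental generator `x` over the algebraically closed `K'`
(`isDefectlessField_of_residueTranscendental_of_algClosedVT`, `DefectlessCoarsening.lean`, from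
`Kuhlmann2010StabilityAlgClosedValueTranscendental`), and separable defectlessness descends to
`K(x)` (`IsSeparablyDefectlessField.of_isDenseIn`, `SeparablyDefectlessDenseDescent.lean`). When
the valuation is trivial on `K`, `(K(x), v)` is even defectless
(`isDefectlessField_of_transcendental_of_adjoin_eq_top`, `DefectlessDedekind.lean`).

## Content (PROVED)

* `isResidueTranscendental_map` — residue-transcendence passes along a field embedding
  `ι : Ω → Ω'` with `ι⁻¹(V') = V`.
* `Kuhlmann2010SeparablyDefectlessRationalRT_sepClosed.of_algClosedVT` —
  `Kuhlmann2010StabilityAlgClosedValueTranscendental → Kuhlmann2010SeparablyDefectlessRationalRT_sepClosed`.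
* `Kuhlmann2010SeparablyDefectlessRationalRT_sepClosed_holds` — **the DISCHARGE**, (R2) for
  `K̃(x)` being discharged (`Kuhlmann2010StabilityAlgClosedValueTranscendental_holds`,
  `GeneralizedStabilityAlgClosedHolds.lean`).

## Sources

* F.-V. Kuhlmann, Trans. AMS 362 (2010) = arXiv:1003.5678: Thm. 1.1, §5 (p. 20; Lemma 5.2
  (R2)). [Kuhlmann2010]
* F.-V. Kuhlmann, Israel J. Math. 234 (2019) = arXiv:1701.05508, proof of Prop. 5.6 (the use).
  [Kuhlmann2019]
-/

noncomputable section

open IsLocalRing Polynomial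

namespace Literature.AlgebraicGeometry.Resolution

universe u

/-! ### Residue-transcendence along a field embedding -/

/-- **Residue-transcendence passes along a field embedding.** For `ι : Ω → Ω'` and a valuation
ring `V'` of `Ω'`, if `x` is residue-transcendental over `K` for `ι⁻¹(V')`, then `ι x` is
residue-transcendental over `ι(K)` for `V'`: the residue field of `ι⁻¹(V')` embeds into that of
`V'` (`residueFieldHom`), mapping the residue field of `K` onto that of `ι(K)`. [folklore] -/
theorem isResidueTranscendental_map {Ω Ω' : Type u} [Field Ω] [Field Ω'] [Algebra Ω Ω']
    (V' : ValuationSubring Ω') {K : Subfield Ω} {x : Ω}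
    (hx : IsResidueTranscendental (V'.comap (algebraMap Ω Ω')) K x) :
    IsResidueTranscendental V' (K.map (algebraMap Ω Ω')) (algebraMap Ω Ω' x) := by
  obtain ⟨hxV, htr⟩ := hx
  set ι : Ω →+* Ω' := algebraMap Ω Ω' with hι
  set V : ValuationSubring Ω := V'.comap (algebraMap Ω Ω') with hV
  set ρ : ResidueField V →+* ResidueField V' := residueFieldHom Ω V' with hρ
  have hρres : ∀ (a : Ω) (ha : a ∈ V), ρ (residue V ⟨a, ha⟩) = residue V' ⟨ι a, ha⟩ := by
    intro a ha
    rw [hρ, residueFieldHom_residue]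
    rfl
  have hxV' : ι x ∈ V' := hxV
  refine ⟨hxV', ?_⟩
  -- the residue field of `ι(K)` is the image of that of `K`
  have hmap : (resField V K).map ρ = resField V' (K.map ι) := by
    ext r'
    constructor
    · intro hr'
      obtain ⟨r, hr, rfl⟩ := Subfield.mem_map.mp hr'
      obtain ⟨a, haK, rfl⟩ := (mem_resField_iff V K r).mp hr
      rw [hρres a a.2]
      exact residue_mem_resField V' ⟨ι a, a.2⟩ (Subfield.mem_map.mpr ⟨a, haK, rfl⟩)
    · intro hr'
      obtain ⟨a', ha'K, rfl⟩ := (mem_resField_iff V' (K.map ι) r').mp hr'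
      obtain ⟨a, haK, haa'⟩ := Subfield.mem_map.mp ha'K
      have haV : a ∈ V := by
        change ι a ∈ V'
        rw [haa']
        exact a'.2
      refine Subfield.mem_map.mpr ⟨residue V ⟨a, haV⟩, residue_mem_resField V ⟨a, haV⟩ haK, ?_⟩
      rw [hρres a haV]
      congr 1
      exact Subtype.ext haa'
  have hr : residue V' ⟨ι x, hxV'⟩ = ρ (residue V ⟨x, hxV⟩) := (hρres x hxV).symm
  rw [← hmap, hr, transcendental_map_iff]
  exact htr

/-! ### The reduction -/

/-- **Kuhlmann 2010, Thm. 1.1, "separably defectless" clause for `K(x)` (`x`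
residue-transcendental, `K` separably closed), from (R2) for `K'(x)` over the algebraically
closed `K' = K̃`** (`Kuhlmann2010StabilityAlgClosedValueTranscendental`, through
`isDefectlessField_of_residueTranscendental_of_algClosedVT`). PROVED along the printed proof
(§5, p. 20) with the completion replaced by the algebraic closure of `K`, in which `K` is dense
when the valuation is non-trivial on `K` (when it is trivial, `(K(x), v)` is defectless by
`isDefectlessField_of_transcendental_of_adjoin_eq_top`): `K(x)` is dense in `K'(x)`, `K'(x)|K(x)`
is purely inseparable, `(K'(x), v)` is defectless by (R2), and separable defectlessness descends
to dense subfields of purely inseparable extensions. [cite: Kuhlmann2010, Thm. 1.1 and Section 5 (p. 20)] -/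
theorem Kuhlmann2010SeparablyDefectlessRationalRT_sepClosed.of_algClosedVT
    (hB : Kuhlmann2010StabilityAlgClosedValueTranscendental.{u}) :
    Kuhlmann2010SeparablyDefectlessRationalRT_sepClosed.{u} := by
  intro Ω _ V K x hK hx hcof
  classical
  haveI := hK
  set E : Subfield Ω := Subfield.closure ((K : Set Ω) ∪ {x}) with hE
  have hxE : x ∈ E := Subfield.subset_closure (Or.inr rfl)
  have hxt : Transcendental K x := hx.transcendental
  -- Case 1: the valuation is trivial on `K`
  by_cases htriv : ∀ a ∈ K, a ∈ V
  · let M : IntermediateField K Ω := IntermediateField.adjoin K ({x} : Set Ω)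
    have hxM : x ∈ M := IntermediateField.mem_adjoin_simple_self K x
    have hMdef : IsDefectlessField M (V.comap (algebraMap M Ω)) := by
      refine isDefectlessField_of_transcendental_of_adjoin_eq_top (K := K)
        (V.comap (algebraMap M Ω)) (t := (⟨x, hxM⟩ : M)) ?_ (adjoin_gen_eq_top x K hxM) ?_
      · exact (transcendental_algebraMap_iff (algebraMap M Ω).injective).mp hxt
      · intro c
        exact htriv c c.2
    have hME : M.toSubfield = E := by
      ext y
      rw [IntermediateField.mem_toSubfield, mem_adjoin_subfield_iff]
    let φ : M ≃+* E := RingEquiv.subfieldCongr hME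
    refine (IsDefectlessField.congr φ ?_ hMdef).isSeparablyDefectlessField
    ext y
    rfl
  -- Case 2: `v(π) < 1` for some `π ∈ K^×`
  push Not at htriv
  obtain ⟨a, haK, haV⟩ := htriv
  have ha1 : 1 < V.valuation a := by
    rw [← not_le, V.valuation_le_one_iff]
    exact haV
  have ha0 : a ≠ 0 := fun h => haV (h ▸ V.zero_mem)
  obtain ⟨π, hπK, hπ0, hπ1⟩ : ∃ π ∈ K, π ≠ 0 ∧ V.valuation π < 1 :=
    ⟨a⁻¹, inv_mem haK, inv_ne_zero ha0, by rw [map_inv₀]; exact inv_lt_one_of_one_lt₀ ha1⟩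
  -- Step 2: embed into an algebraic closure `Ω'` of `Ω` and extend `V`
  let Ω' : Type u := AlgebraicClosure Ω
  let ι : Ω →+* Ω' := algebraMap Ω Ω'
  obtain ⟨V', hV'⟩ := exists_valuationSubring_comap_eq (Ω := Ω') V
  subst hV'
  set K₁ : Subfield Ω' := K.map ι with hK₁
  set x₁ : Ω' := ι x with hx₁def
  have hE₁ : E.map ι = Subfield.closure ((K₁ : Set Ω') ∪ {x₁}) := by
    rw [hE, map_closure_union, Set.image_singleton]
  haveI : IsSepClosed K₁ := isSepClosed_map ι K
  have hx₁ : IsResidueTranscendental V' K₁ x₁ := isResidueTranscendental_map V' hx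
  have hcof₁ : IsValueCofinal V' K₁ (E.map ι) := by
    intro a ha ha0
    obtain ⟨a₀, ha₀E, rfl⟩ := Subfield.mem_map.mp ha
    have ha₀0 : a₀ ≠ 0 := fun h => ha0 (by rw [h, map_zero])
    obtain ⟨b, hbK, hb0, hb⟩ := hcof a₀ ha₀E ha₀0
    refine ⟨ι b, Subfield.mem_map.mpr ⟨b, hbK, rfl⟩, (map_ne_zero ι).mpr hb0, ?_⟩
    have := ((isEquiv_valuation_comap ι (V := V'.comap (algebraMap Ω Ω')) rfl) b a₀).mpr hb
    simpa only [Valuation.comap_apply] using this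
  have hπ₁K : ι π ∈ K₁ := Subfield.mem_map.mpr ⟨π, hπK, rfl⟩
  have hπ₁0 : ι π ≠ 0 := (map_ne_zero ι).mpr hπ0
  have hπ₁ : V'.valuation (ι π) < 1 :=
    (valuation_map_lt_one_iff ι (V := V'.comap (algebraMap Ω Ω')) rfl π).mpr hπ1
  -- Step 3: `K'` = the algebraic closure of `K₁` in `Ω'`
  set Kt : IntermediateField K₁ Ω' := algebraicClosure K₁ Ω' with hKt
  haveI : IsAlgClosed Kt := IsAlgClosure.isAlgClosed K₁
  set K' : Subfield Ω' := Kt.toSubfield with hK'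
  have hKK' : K₁ ≤ K' := fun c hc => by
    have : (algebraMap K₁ Ω') ⟨c, hc⟩ ∈ Kt := Kt.algebraMap_mem ⟨c, hc⟩
    exact this
  have hpi : ∀ y ∈ K', ∃ n : ℕ, y ^ (ringExpChar Ω') ^ n ∈ K₁ := fun y hy =>
    exists_pow_ringExpChar_mem_of_isAlgebraic K₁ (mem_algebraicClosure_iff.mp hy)
  have hdense : IsDenseIn V' K₁ K' := isDenseIn_of_isSepClosed_of_pow_mem V' K₁ K' hπ₁K hπ₁0 hπ₁ hpi
  have hx' : IsResidueTranscendental V' K' x₁ := hx₁.of_pow_mem hKK' hpi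
  set E' : Subfield Ω' := Subfield.closure ((K' : Set Ω') ∪ {x₁}) with hE'
  have hdenseE : IsDenseIn V' (E.map ι) E' := by
    rw [hE₁]
    exact isDenseIn_closure_insert V' x₁ hdense
      (coinitial_closure_insert_of_isResidueTranscendental hx')
  have hEE' : E.map ι ≤ E' := by
    rw [hE₁]
    exact Subfield.closure_mono (Set.union_subset_union_left _ hKK')
  -- Step 4: `(K'(x), v)` is a defectless field, by (R2) (residue-transcendental generator)
  set M : IntermediateField Kt Ω' := IntermediateField.adjoin Kt ({x₁} : Set Ω') with hM
  have hx₁M : x₁ ∈ M := IntermediateField.subset_adjoin _ _ rfl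
  obtain ⟨hx₁V', htr'⟩ := hx'
  have hMdef : IsDefectlessField M (V'.comap (algebraMap M Ω')) := by
    have htM : (⟨x₁, hx₁M⟩ : M) ∈ V'.comap (algebraMap M Ω') := hx₁V'
    refine isDefectlessField_of_residueTranscendental_of_algClosedVT hB Kt M
      (V'.comap (algebraMap M Ω')) ⟨⟨x₁, hx₁M⟩, htM⟩ ?_ ?_
    · -- the residue of `x₁` is transcendental over the residue field of `Kt`
      let ρ : ResidueField (V'.comap (algebraMap M Ω')) →+* ResidueField V' := residueFieldHom M V'
      have hρres : ∀ (z : M) (hz : z ∈ V'.comap (algebraMap M Ω')),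
          ρ (residue (V'.comap (algebraMap M Ω')) ⟨z, hz⟩) = residue V' ⟨(z : Ω'), hz⟩ := by
        intro z hz
        change residueFieldHom M V' _ = _
        rw [residueFieldHom_residue]
        rfl
      -- `ρ` maps the residue field of `Kt` into that of `K'`
      have hmem : ∀ r ∈ residueSubfield Kt (V'.comap (algebraMap M Ω')), ρ r ∈ resField V' K' := by
        intro r hr
        obtain ⟨c, hc, rfl⟩ := (mem_residueSubfield_iff Kt (V'.comap (algebraMap M Ω')) r).mp hr
        rw [hρres]
        exact residue_mem_resField V' ⟨((algebraMap Kt M c : M) : Ω'), hc⟩ c.2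
      let f : residueSubfield Kt (V'.comap (algebraMap M Ω')) →+* resField V' K' :=
        (ρ.comp (residueSubfield Kt (V'.comap (algebraMap M Ω'))).subtype).codRestrict (resField V' K')
          fun r => hmem r r.2
      have hT : Transcendental (resField V' K')
          (ρ (residue (V'.comap (algebraMap M Ω')) ⟨⟨x₁, hx₁M⟩, htM⟩)) := by
        rw [hρres]
        exact htr'
      exact Transcendental.of_ringHom_of_comp_eq f ρ hT (RingHom.injective _) (RingHom.ext fun _ => rfl)
    · apply IntermediateField.lift_injective M
      rw [IntermediateField.lift_adjoin, IntermediateField.lift_top, Set.image_singleton]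
  -- `M` and `E'` have the same elements
  have hrange : Set.range (algebraMap Kt Ω') = (K' : Set Ω') := by
    ext y
    constructor
    · rintro ⟨w, rfl⟩; exact w.2
    · intro hy; exact ⟨⟨y, hy⟩, rfl⟩
  have hME' : ∀ y : Ω', y ∈ M ↔ y ∈ E' := by
    intro y
    rw [← IntermediateField.mem_toSubfield, hM, IntermediateField.adjoin_toSubfield, hrange]
  let φ : M ≃+* E' :=
    { toFun := fun y => ⟨y, (hME' y).mp y.2⟩
      invFun := fun y => ⟨y, (hME' y).mpr y.2⟩
      left_inv := fun y => rfl
      right_inv := fun y => rfl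
      map_mul' := fun _ _ => rfl
      map_add' := fun _ _ => rfl }
  have hφO : V'.comap (algebraMap M Ω') = (V'.comap (algebraMap E' Ω')).comap φ.toRingHom := by
    ext y; rfl
  have hE'def : IsSeparablyDefectlessField E' (V'.comap (algebraMap E' Ω')) :=
    (IsDefectlessField.congr φ hφO hMdef).isSeparablyDefectlessField
  -- Step 5: `E' | E₁` is purely inseparable (generated over `E₁ = ι(E)` by `K'`)
  have hxE₁ : x₁ ∈ E.map ι := by rw [hE₁]; exact Subfield.subset_closure (Or.inr rfl)
  have hpi' : ∀ y ∈ E', ∃ n : ℕ, y ^ (ringExpChar Ω') ^ n ∈ E.map ι := by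
    haveI : ExpChar (E.map ι) (ringExpChar Ω') := by
      rw [← ringExpChar_subfield_eq (E.map ι)]; exact ringExpChar.expChar _
    let N : IntermediateField (E.map ι) Ω' := IntermediateField.adjoin (E.map ι) (K' : Set Ω')
    haveI hNpi : IsPurelyInseparable (E.map ι) N := by
      rw [IntermediateField.isPurelyInseparable_adjoin_iff_pow_mem (E.map ι) Ω' (ringExpChar Ω')]
      intro y hy
      obtain ⟨n, hn⟩ := hpi y hy
      have hmem : y ^ (ringExpChar Ω') ^ n ∈ E.map ι := by
        rw [hE₁]; exact Subfield.subset_closure (Or.inl hn)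
      exact ⟨n, ⟨⟨y ^ (ringExpChar Ω') ^ n, hmem⟩, rfl⟩⟩
    have hE'N : ∀ y ∈ E', y ∈ N := by
      have hle : E' ≤ N.toSubfield := by
        rw [hE', Subfield.closure_le]
        rintro z (hz | hz)
        · exact IntermediateField.subset_adjoin _ _ hz
        · rw [Set.mem_singleton_iff] at hz
          subst hz
          exact N.algebraMap_mem ⟨_, hxE₁⟩
      exact fun y hy => hle hy
    intro y hy
    obtain ⟨n, ⟨z, hz⟩⟩ := IsPurelyInseparable.pow_mem (E.map ι) (ringExpChar Ω') (⟨y, hE'N y hy⟩ : N)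
    refine ⟨n, ?_⟩
    have := congrArg (fun w : N => (w : Ω')) hz
    simp only [IntermediateField.coe_pow] at this
    change (z : Ω') = y ^ (ringExpChar Ω') ^ n at this
    rw [← this]
    exact z.2
  -- Step 6: descent to the dense subfield `E₁ = ι(E)`
  have hE₁def : IsSeparablyDefectlessField (E.map ι) (V'.comap (algebraMap (E.map ι) Ω')) :=
    IsSeparablyDefectlessField.of_isDenseIn V' hEE' hpi' hdenseE hE'def
  -- Step 7: transport back along `E ≃ ι(E)`
  obtain ⟨e, he⟩ := exists_ringEquiv_map ι E
  refine IsSeparablyDefectlessField.congr e.symm ?_ hE₁def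
  ext w
  simp only [ValuationSubring.mem_comap]
  change (w : Ω') ∈ V' ↔ ι ((e.symm w : E) : Ω) ∈ V'
  rw [← he (e.symm w), RingEquiv.apply_symm_apply]

/-- **DISCHARGE of `Kuhlmann2010SeparablyDefectlessRationalRT_sepClosed`** (Kuhlmann 2010,
Thm. 1.1, "separably defectless" clause, for `K(x)` with `x` residue-transcendental over a
separably closed `K`): `Kuhlmann2010SeparablyDefectlessRationalRT_sepClosed.of_algClosedVT`
(density of `K(x)` in `K̃(x)`, (R2) for a residue-transcendental generator through the `x̄`-adic
refinement, descent of separable defectlessness along dense purely inseparable extensions)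
applied to (R2) for `K̃(x)` (`Kuhlmann2010StabilityAlgClosedValueTranscendental_holds`,
`GeneralizedStabilityAlgClosedHolds.lean`). PROVED.
[cite: Kuhlmann2010, Thm. 1.1 (with Section 5, p. 20 and Lemmas 5.2–5.4)] -/
theorem Kuhlmann2010SeparablyDefectlessRationalRT_sepClosed_holds :
    Kuhlmann2010SeparablyDefectlessRationalRT_sepClosed.{u} :=
  Kuhlmann2010SeparablyDefectlessRationalRT_sepClosed.of_algClosedVT
    Kuhlmann2010StabilityAlgClosedValueTranscendental_holds

end Literature.AlgebraicGeometry.Resolution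

end
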